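import Summits.QuantumFields.BalabanUV.T4Continuum.Support.DirichletMorreyDecay
import Summits.QuantumFields.BalabanUV.Beta.GAN24.DirichletBoxTrace

/-!
# `BalabanUV.T4Continuum.Support.DirichletMorreyDecayBlock` — NE2 (node U1a) formalisation swarm, sub-row `T4-U1a.S-NE2-D1-DIRICHLET°`,
# supplier item «Δ1-HOLEFILL» (junction): THE BLOCK-REGION INSTANCE of the Morrey decay — at the lower corner of a unit block `β₀`, for every
# sign pattern `σ` whose block `β₀ − Σ_{σλ = false} e_λ` is OUTSIDE the block set `S`, a field supported in `blockReg n M S` vanishes on the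
# chart octant, so `DirichletMorreyDecay.morrey_decay` applies with NO chart hypothesis left (unit b2b-balaban-t4-ne2-formalise-leaf-08, gen 6, file 9)

HONEST FRAMING.  Rung (B)+1 bookkeeping at MODEL level (finite torus, one lattice field); [folklore]; NE2 (U1a) is NOT proved by this file;
spine PROVED 0/9 unchanged; NOT infinite volume, NOT the mass gap, NOT Clay.  HONEST DEPENDENCY (verbatim): «continuum YM on T⁴ ⇐ BetaPertH ∧
nine spine estimates (0/9 proved); BetaPertH ⇐ (D1) ∧ (D4) ∧ CAP+tail; G-an2-4 gates asym, D1 and NE2/3/4.»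

WHAT THIS FILE PROVES (0 sorry).  On the torus `Tor (fine n M)` of [B5] (1.6) (blocks `bpt`, `blockOf`, gan24-p2's `blockReg`):
 * `cornerBlock M β₀ σ = β₀ − Σ_{λ : σ λ = false} e_λ` (one of the `2^d` blocks at the lower corner of `β₀`) and the base point
   `cornerBase n M β₀ K = n·β₀ − 2K·𝟙` of the cube of side `4K` centred at that corner;
 * **`blockOf_chart_cornerBase`**: for `2K ≤ n`, `4K = nn + 1` and `j ∈ oct σ K`, `blockOf (chart (cornerBase β₀ K) j) = cornerBlock β₀ σ`
   (explicit block digits: `j λ − 2K` on the `σ`-side, `n − 2K + j λ` on the other);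
 * **`vanish_oct_of_blockReg`**: `z = 0` off `blockReg n M S` and `cornerBlock β₀ σ ∉ S` ⇒ `z ∘ chart (cornerBase β₀ K) = 0` on `oct σ K`;
 * **`morrey_decay_blockReg`**: `DirichletMorreyDecay.morrey_decay` at the corner of `β₀` with that vanishing supplied — the energy of `z` in
   the cube of side `4m` around the corner is at most `θ_d^J·(energy in the cube of side `4·2^J m` + source)`, `2·2^J m ≤ n`, `4·2^J m ≤ n·M ν`.

ABSOLUTE RULE (cell, verbatim): «No internally-minted statement may enter as a cited fact. Every hypothesis is either kernel-proved in
this package or a verbatim quotation of a PUBLISHED theorem with page reference. The manuscript(s) under audit are NOT citable for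
their own disputed steps — they are the thing under adjudication; programme-internal (2001/route/tribunal) claims are never citable.»
[folklore]; plain data `def`s (`cornerBlock`, `cornerBase`, `cornerDigits`), no `def … : Prop` fact.  NOT CLAIMED: the assembly H-E/H-F; NE2.
-/

noncomputable section

open scoped BigOperators ComplexConjugate Matrix
open Finset

namespace Summit.QuantumFields.BalabanUV.T4Continuum.DirichletMorreyDecayBlock

open Literature.MathematicalPhysics.QuantumFieldTheory.Balaban1983to89.B5Prop11Plancherel (Tor fine unitVec)
open Literature.MathematicalPhysics.QuantumFieldTheory.Balaban1983to89.B5Action121 (LapS)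
open Literature.MathematicalPhysics.QuantumFieldTheory.Balaban1983to89.B5Block118 (bpt up iota tstep up_add up_unitVec)
open Literature.MathematicalPhysics.QuantumFieldTheory.Balaban1983to89.B5Blocks16 (blockOf blockOf_bpt)
open Summit.QuantumFields.BalabanUV.T4Continuum.DirichletDirectionalBesov (restrictTo)
open Summit.QuantumFields.BalabanUV.T4Continuum.CoordSlabPoincare (dirOn)
open Summit.QuantumFields.BalabanUV.T4Continuum.CoordOctantBoxes (oct mem_oct)
open Summit.QuantumFields.BalabanUV.T4Continuum.DirichletHoleFillingCutoff (chart)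
open Summit.QuantumFields.BalabanUV.T4Continuum.DirichletHoleFilling (theta)
open Summit.QuantumFields.BalabanUV.T4Continuum.DirichletMorreyDecay (shift morrey_decay)
open Summit.QuantumFields.BalabanUV.Beta.GAN24.DirichletBoxTrace (blockReg)

variable {d : ℕ} (n : ℕ) [NeZero n] (M : Fin d → ℕ) [hM : ∀ μ, NeZero (M μ)]

omit [NeZero n] in
/-- the EXTERIOR-CANDIDATE BLOCK at the lower corner of `β₀` in the sign pattern `σ`: `β₀ − Σ_{λ : σ λ = false} e_λ`. [folklore] -/
def cornerBlock (β₀ : Tor M) (σ : Fin d → Bool) : Tor M := β₀ - ∑ lam ∈ univ.filter (fun lam : Fin d => σ lam = false), unitVec M lam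

/-- the BASE POINT `n·β₀ − 2K·𝟙` of the cube of side `4K` centred at the lower corner of the block `β₀`. [folklore] -/
def cornerBase (β₀ : Tor M) (K : ℕ) : Tor (fine n M) := up n M β₀ - fun ν => ((2 * K : ℕ) : ZMod (fine n M ν))

/-- the block digits of a chart point of the octant: `j λ − 2K` on the `σ`-side, `n − 2K + j λ` on the other. [folklore] -/
def cornerDigits (σ : Fin d → Bool) (K : ℕ) {nn : ℕ} (j : Fin d → Fin (nn + 1)) : Fin d → Fin n :=
  fun lam => if σ lam then ⟨((j lam : ℕ) - 2 * K) % n, Nat.mod_lt _ (Nat.pos_of_ne_zero (NeZero.ne n))⟩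
    else ⟨(n - 2 * K + (j lam : ℕ)) % n, Nat.mod_lt _ (Nat.pos_of_ne_zero (NeZero.ne n))⟩

omit [NeZero n] hM in
/-- `up` of a finite sum. [folklore] -/
theorem up_sum (s : Finset (Fin d)) (f : Fin d → Tor M) : up n M (∑ i ∈ s, f i) = ∑ i ∈ s, up n M (f i) := by
  classical
  refine Finset.induction_on s ?_ ?_
  · funext ν; simp [up]
  · intro a s ha ih
    rw [Finset.sum_insert ha, Finset.sum_insert ha, up_add, ih]

omit [NeZero n] hM in
/-- the `λ`-coordinate of `up (Σ_{σμ = false} e_μ)`: `n` if `σ λ = false`, else `0`. [folklore] -/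
theorem up_sum_unitVec_apply (σ : Fin d → Bool) (lam : Fin d) :
    up n M (∑ mu ∈ univ.filter (fun mu : Fin d => σ mu = false), unitVec M mu) lam
      = if σ lam = false then ((n : ℕ) : ZMod (fine n M lam)) else 0 := by
  rw [up_sum, Finset.sum_apply]
  simp_rw [up_unitVec, tstep]
  rw [Finset.sum_ite_eq]
  simp only [Finset.mem_filter, Finset.mem_univ, true_and]

omit hM in
/-- **THE CHART OCTANT LIES IN THE CORNER BLOCK**: for `2K ≤ n`, `4K = nn + 1`, `j ∈ oct σ K`,
`chart (cornerBase β₀ K) j = bpt (cornerBlock β₀ σ) (cornerDigits σ K j)`. [folklore] -/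
theorem chart_cornerBase_eq_bpt (β₀ : Tor M) (σ : Fin d → Bool) {K : ℕ} (hK : 2 * K ≤ n) {nn : ℕ} (hnn : 4 * K = nn + 1)
    {j : Fin d → Fin (nn + 1)} (hj : j ∈ oct (n := nn) K σ) :
    chart (fine n M) (cornerBase n M β₀ K) j = bpt n M (cornerBlock M β₀ σ) (cornerDigits n σ K j) := by
  rw [mem_oct] at hj
  funext lam
  have hjl := (j lam).isLt
  have hσ := hj lam
  have hup : up n M (cornerBlock M β₀ σ) lam
      = up n M β₀ lam - (if σ lam = false then ((n : ℕ) : ZMod (fine n M lam)) else 0) := by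
    rw [cornerBlock, eq_sub_iff_add_eq, ← up_sum_unitVec_apply n M σ lam, ← Pi.add_apply, ← up_add, sub_add_cancel]
  simp only [chart, cornerBase, bpt, iota, Pi.add_apply, Pi.sub_apply, hup, cornerDigits]
  cases hb : σ lam
  · -- far side: digit `n − 2K + j λ`
    have hlt : (j lam : ℕ) < 2 * K := by
      by_contra h; push Not at h; have := hσ.mp h; rw [hb] at this; exact Bool.false_ne_true this
    simp only [Bool.false_eq_true, if_false, if_true]
    rw [Nat.mod_eq_of_lt (by omega), Nat.cast_add, Nat.cast_sub hK, Nat.cast_mul, Nat.cast_ofNat]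
    ring
  · -- σ side: digit `j λ − 2K`
    have hge : 2 * K ≤ (j lam : ℕ) := hσ.mpr hb
    simp only [if_true, Bool.true_eq_false, if_false]
    rw [Nat.mod_eq_of_lt (by omega), Nat.cast_sub hge, Nat.cast_mul, Nat.cast_ofNat, sub_zero]
    ring

/-- **`blockOf (chart (cornerBase β₀ K) j) = cornerBlock β₀ σ`** for `j ∈ oct σ K`. [folklore] -/
theorem blockOf_chart_cornerBase (β₀ : Tor M) (σ : Fin d → Bool) {K : ℕ} (hK : 2 * K ≤ n) {nn : ℕ} (hnn : 4 * K = nn + 1)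
    {j : Fin d → Fin (nn + 1)} (hj : j ∈ oct (n := nn) K σ) :
    blockOf n M (chart (fine n M) (cornerBase n M β₀ K) j) = cornerBlock M β₀ σ := by
  rw [chart_cornerBase_eq_bpt n M β₀ σ hK hnn hj, blockOf_bpt]

/-- **VANISHING ON THE CHART OCTANT** from support in a block region: `z = 0` off `blockReg n M S`, `cornerBlock β₀ σ ∉ S` ⇒
`z (chart (cornerBase β₀ K) j) = 0` for `j ∈ oct σ K`. [folklore] -/
theorem vanish_oct_of_blockReg (S : Tor M → Prop) [DecidablePred S] {z : Tor (fine n M) → ℂ} (hz : ∀ x, ¬ blockReg n M S x → z x = 0)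
    (β₀ : Tor M) (σ : Fin d → Bool) (hβ : ¬ S (cornerBlock M β₀ σ)) {K : ℕ} (hK : 2 * K ≤ n) {nn : ℕ} (hnn : 4 * K = nn + 1) :
    ∀ j ∈ oct (n := nn) K σ, z (chart (fine n M) (cornerBase n M β₀ K) j) = 0 :=
  fun _ hj => hz _ (by rw [blockReg, blockOf_chart_cornerBase n M β₀ σ hK hnn hj]; exact hβ)

/-- **MORREY DECAY AT A CORNER OF AN EXTERIOR BLOCK OF A BLOCK REGION.**  `d ≥ 2`, `c ≠ 0`, `z` supported in `blockReg n M S`, a block `β₀`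
and a sign pattern `σ` with `cornerBlock β₀ σ ∉ S`; scales `m ≥ 1`, `4m = n₀ + 1`, `K = 2^J m` with `2K ≤ n`, `4K = nn + 1 ≤ n·M ν`.  Then the
Dirichlet form of `z` over the cube of side `4m` centred at the lower corner of `β₀` is at most
`θ_d^J·(the form over the cube of side 4K + 64(1+2^d)K²/‖c‖⁴·Σ_{that cube}‖1_{blockReg S}Δz‖²)`. [folklore] -/
theorem morrey_decay_blockReg (hd : 2 ≤ d) {c : ℂ} (hc : c ≠ 0) (S : Tor M → Prop) [DecidablePred S] {z : Tor (fine n M) → ℂ}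
    (hz : ∀ x, ¬ blockReg n M S x → z x = 0) (β₀ : Tor M) (σ : Fin d → Bool) (hβ : ¬ S (cornerBlock M β₀ σ))
    {m : ℕ} (hm : 1 ≤ m) {n₀ : ℕ} (hn₀ : 4 * m = n₀ + 1) (J : ℕ) {nn : ℕ} (hnn : 4 * (2 ^ J * m) = nn + 1)
    (hK : 2 * (2 ^ J * m) ≤ n) (hN' : ∀ ν, nn + 1 ≤ fine n M ν) :
    dirOn (univ : Finset (Fin d → Fin (n₀ + 1)))
        (z ∘ chart (fine n M) (n := n₀) (shift (fine n M) (2 * 2 ^ J * m - 2 * m) (cornerBase n M β₀ (2 ^ J * m))))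
      ≤ theta d ^ J * (dirOn (univ : Finset (Fin d → Fin (nn + 1))) (z ∘ chart (fine n M) (n := nn) (cornerBase n M β₀ (2 ^ J * m)))
          + 64 * (1 + 2 ^ d) * ((2 ^ J * m : ℕ) : ℝ) ^ 2 / ‖c‖ ^ 4
            * ∑ j : Fin d → Fin (nn + 1), ‖restrictTo (blockReg n M S) (LapS (fine n M) c *ᵥ z) (chart (fine n M) (cornerBase n M β₀ (2 ^ J * m)) j)‖ ^ 2) :=
  morrey_decay (fine n M) hd hc hz σ hm hn₀ J hnn hN' _ (vanish_oct_of_blockReg n M S hz β₀ σ hβ hK hnn)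

end Summit.QuantumFields.BalabanUV.T4Continuum.DirichletMorreyDecayBlock

end
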